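import Summits.QuantumFields.BalabanUV.Beta.D1BFx.DressingParityTransport
import Summits.QuantumFields.BalabanUV.Beta.CombOneShotJets
import Summits.QuantumFields.BalabanUV.Beta.CombFormSlotGaugeLetter
import Summits.QuantumFields.BalabanUV.Beta.SymmetrisedStepJetsParity
import Summits.QuantumFields.BalabanUV.Beta.CombChartWardSockets
import Summits.QuantumFields.BalabanUV.Beta.StepReflectionRec

/-!
# Road «BF-x» — (J1) RESIDUE S1–S5, PART B: THE ROAD's STRUCTURAL SOCKETS OF THE (III′) LITERAL's FIRST-ORDER STENCIL, RAW AND DRESSED, AND AT `JcOf`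
# (unit `b2b-balaban-beta-d1-formalise-leaf-01`, gen 27 — head lineage of the (L1)(L2) packaging; OWNER d1-p2 g21's `J1-RESIDUE-SPEC.md` v0 §2 rows S1–S5)

HONEST DEPENDENCY (page 1, mandatory): continuum YM on T⁴ ⇐ BetaPertH ∧ nine spine estimates (0/9 proved); BetaPertH ⇐ (D1) ∧ (D4) ∧ CAP+tail;
G-an2-4 gates asym, D1 and NE2/3/4.  HONEST FRAMING (cell contract, verbatim): «discharging `BetaPertH` makes Bałaban's UV stability UNCONDITIONAL — a real
constructive-QFT result; it is NOT the continuum limit and NOT the Clay problem.»  THIS FILE: [folklore] by-name bookkeeping over OUR typed objects; no estimate of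
Bałaban's; it discharges NO row of the wall by itself — it turns the END's DISPLAYED structural sockets `hS hCs hδS hScovB hSmm hSfm hSff` (PART 19 ∕ 21 of
`RoadEndBFxRoadScales*`) into theorems AT the literal of record once the (J1) pin `S n :=` is chosen (an2 R-D1-g42-3: «sockets on the dressed `S` family = dictionary
rows», JA-TABLE v1.6 Δ6 (iii)); 0 root-level binders of row D1 discharged (hW ∕ hR-sockets ∕ hSX-socket ∕ D1Tel ∕ D1Rep); NOT D1, NOT BetaPertH, NOT continuum, NOT Clay.

WHAT IT SAYS (`d + 1 = 4`; the generic transport is PART A `D1BFx/DressingParityTransport`).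
* §3 THE RAW LITERAL `(JsB12CombSh0 hn N tabs cΛ cB j).S`, every level `j`: row-parity-odd for ANY table record under the table parities (V-p)(H-p) (an2's
  `SymmetrisedStepJetsParity.trK_SrecOf` fed `decays_GcombSh` ∕ `trK_GcombSh` and the record's own (LV)(LH)); mm block `= 0` under (V-mm)(H-mm) (`JsB12CombSh0_S_zero ∕ _succ`,
  `wilsonA` ff-only by definition, `SLam_apply_eq_zero`, `e3OfK_inr_inr`); at an1's closed record `symTablesAn1S2 3 n cΛ` all of it UNCONDITIONALLY
  (an1's `trK_symVhSAt ∕ trK_symHessFFAt` — the same instance an2's `CombFormSlotPeriodised.trK_JsB12CombSh0_S_an1TablesS2` proves, re-derived here to keep that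
  door-chain file out of the road's cone —, `packVH_inr_inr`, `symHessFFAt_inr`) — the road's `hSmm ∕ hSfm ∕ hSff` shapes; `hScovB` = an2's `JsB12CombSh0_S_translate`
  in the END's cast shape.
* §4 THE DRESSED LITERAL `(JsB12CombShSym hn N tabs cΛ cB j).S = (dressSymAt ρ_c (dressAt ρ_c J⁰)).S` (`JsB12CombShSym_eq`): **`JsB12CombShSym_S_translate`** (any `tabs`,
  every `j`), parity ∕ mm (generic `tabs` under the letters; unconditional at an1's record), the three shapes, and S1's `0 ≤ .Cs` read off the datum.
* §5 AT an2's ONE-SHOT COMPOSITE JETS `JcOf hLc N cΛ cB m` (blocking `n = Lc^m`, `CombOneShotJets` p339189): the seven sockets in the END's binder shapes verbatim —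
  `JcOf_locStencil`, `JcOf_Cs_nonneg`, `JcOf_δ_pos`, `JcOf_S_covB`, `JcOf_S_inr_inr`, `JcOf_S_inl_inr`, `JcOf_S_inl_inl` (+ the parity form `trK_JcOf_S`).
* §6 DEF-FREE `by_cases` WRAPPERS for an odd-indexed pin `S n := if h : Odd n then F n h else 0` (the END keeps its binder `S : ℕ → …`; its `∀ n ≥ 2` sockets
  `hScovB ∕ hSmm ∕ hSfm ∕ hSff ∕ hS ∕ hCs ∕ hδS` follow from the per-datum lemmas of §3 or §4 at the consumer's choice of `F`): `pin_covB`, `pin_entry`, `pin_entry_zero`,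
  `pin_locStencil` (+ `locStencil_zero`), `pin_Cs_nonneg`, `pin_δ_pos`; and ONE admissible dressed pin read at the scales, `pin_dressed_at_pow` (= `(JcOf … m).S` at `Lc^m`).
NOT HERE (left where the spec routes them): S6 (the `S₂` sockets — needs the (III′) pack-bridges, spec v0.1 S6′), S7 (the MASS letters `hSs hSm` — the row owner's
currency ∕ weights ruling; gan24-leaf-05 g56 W-2: to be asked of the RAW tables with `colH (GcombSh n 0)` weights), S8 (Q-DICT-N on the concrete `S`).
ABSOLUTE RULE (cell charter, verbatim): «No internally-minted statement may enter as a cited fact. Every hypothesis is either kernel-proved in this package or a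
verbatim quotation of a PUBLISHED theorem with page reference. The manuscript(s) under audit are NOT citable for their own disputed steps — they are the thing
under adjudication; programme-internal (2001/route/tribunal) claims are never citable.»  No `def`, no `def … : Prop`, nothing cited as mathematics; 0 sorry.
-/

noncomputable section

open Finset
open scoped BigOperators
open Literature.MathematicalPhysics.QuantumFieldTheory
open Literature.MathematicalPhysics.QuantumFieldTheory.Balaban1983to89
open Literature.MathematicalPhysics.QuantumFieldTheory.Balaban1983to89.Beta
open ExpKernelCalculus (MKer BiLoc shiftK)
open OneStepResolventKernel (Fib JetData LocStencil)
open AffineAveraging (box toSite)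
open AveragingContoursRooted (ctr ctrOff ctrOff_mem_box)
open StepJetData (wilsonA)
open Summit.QuantumFields.BalabanUV.Beta.TameKernelCalculus (trK trK_apply)
open Summit.QuantumFields.BalabanUV.Beta.BorderedHessian (sgnK sgnK_apply sgnF sgnF_inl sgnF_inr)
open Summit.QuantumFields.BalabanUV.Beta.AxialDressingRooted (dressAt dressAt_S one_le_of_neZero)
open Summit.QuantumFields.BalabanUV.Beta.SymmetrisedDressingDress (dressSymAt dressSymAt_S)
open Summit.QuantumFields.BalabanUV.Beta.SymmetrisedStepJets (SymTables)
open Summit.QuantumFields.BalabanUV.Beta.SymmetrisedStepJetsParity (trK_SrecOf)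
open Summit.QuantumFields.BalabanUV.Beta.SymAveragingHessianCounts (symVhSAt symHessFFAt symHessFFAt_inr)
open Summit.QuantumFields.BalabanUV.Beta.SymTablesAn1FirstOrder (trK_symVhSAt trK_symHessFFAt)
open Summit.QuantumFields.BalabanUV.Beta.SymSecondOrderTablesAn1 (symTablesAn1S2 symTablesAn1S2_V symTablesAn1S2_H)
open Summit.QuantumFields.BalabanUV.Beta.CombChartStepJets (GcombSh decays_GcombSh ScombOf_eq JsComb0Of_S JsB12CombSh0 JsB12CombSh0_eq
  JsB12CombSh0_S_translate)
open Summit.QuantumFields.BalabanUV.Beta.CombChartWardSockets (trK_GcombSh)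
open Summit.QuantumFields.BalabanUV.Beta.CombChartJointEnd (JsB12CombShSym JsB12CombShSym_eq)
open Summit.QuantumFields.BalabanUV.Beta.CombFormSlotGaugeLetter (JsB12CombSh0_S_zero JsB12CombSh0_S_succ)
open Summit.QuantumFields.BalabanUV.Beta.BubbleParity (SLam_apply_eq_zero)
open Summit.QuantumFields.BalabanUV.Beta.CombOneShotJets (JcOf JcOf_apply)
open Summit.QuantumFields.BalabanUV.Beta.SpineRooted (e3OfK_inr_inr)
open Summit.QuantumFields.BalabanUV.Beta.D1BFx.DressingParityTransport

namespace Summit.QuantumFields.BalabanUV.Beta.D1BFx.LiteralStencilSockets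

/-! ## §3 `d + 1 = 4`: the RAW literal `(JsB12CombSh0 hn N tabs cΛ cB j).S`, every level — parity, mm block, the road's shapes, covariance -/

section Raw

variable {n : ℕ} [NeZero n]

/-- [folklore] **THE RAW LITERAL IS ROW-PARITY-ODD AT EVERY LEVEL, ANY TABLE RECORD, UNDER THE TABLE PARITIES (V-p)(H-p)** (an2's `trK_SrecOf` fed the record's own
(LV)(LH), `decays_GcombSh`, `trK_GcombSh`). -/
theorem trK_JsB12CombSh0_S (hn : Odd n) (N : ℕ) (tabs : SymTables 3 n) (cΛ cB : ℝ)
    (hVp : ∀ (κ : Fin 4) (u : Fin 4 → ℤ), trK (tabs.V κ u) = -sgnK (tabs.V κ u))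
    (hHp : ∀ (μ : Fin 4) (y : Fin 4 → ℤ), trK (tabs.H μ y) = -sgnK (tabs.H μ y)) (j : ℕ) (κ : Fin 4) (u : Fin 4 → ℤ) :
    trK ((JsB12CombSh0 hn N tabs cΛ cB j).S κ u) = -sgnK ((JsB12CombSh0 hn N tabs cΛ cB j).S κ u) := by
  rw [JsB12CombSh0_eq, JsComb0Of_S, ScombOf_eq]
  exact trK_SrecOf (d := 3) tabs.hV tabs.hH (decays_GcombSh n) (fun j' => trK_GcombSh (d := 3) (Lc := n) j') hVp hHp _ _ cΛ j κ u

/-- [folklore] (V-p)(H-p) AT an1's RECORD (`trK_symVhSAt`, `trK_symHessFFAt`): **THE RAW LITERAL OF RECORD IS ROW-PARITY-ODD AT EVERY LEVEL** (the instance an2's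
`CombFormSlotPeriodised.trK_JsB12CombSh0_S_an1TablesS2` proves; re-derived from the generic lemma so that the road's cone does not import the door chain). -/
theorem trK_JsB12CombSh0_S_an1 (hn : Odd n) (N : ℕ) (cΛ cB : ℝ) (j : ℕ) (κ : Fin 4) (u : Fin 4 → ℤ) :
    trK ((JsB12CombSh0 hn N (symTablesAn1S2 3 n cΛ) cΛ cB j).S κ u) = -sgnK ((JsB12CombSh0 hn N (symTablesAn1S2 3 n cΛ) cΛ cB j).S κ u) :=
  trK_JsB12CombSh0_S hn N _ cΛ cB (fun κ' u' => by rw [symTablesAn1S2_V]; exact trK_symVhSAt _ _ κ' u')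
    (fun μ y => by rw [symTablesAn1S2_H]; exact trK_symHessFFAt _ _ μ y) j κ u

/-- [folklore] **THE RAW LITERAL HAS NO mm BLOCK, ANY LEVEL, ANY TABLE RECORD WITHOUT mm BLOCKS** ((V-mm) on `tabs.V`, (H-mm) on `tabs.H`): level `0` =
`n⁴ • wilsonA + (−n⁸∕2) • V + cΛ • SLam … H` (`JsB12CombSh0_S_zero`; `wilsonA` is ff-only by definition, `BubbleParity.SLam_apply_eq_zero`), level `j+1` = cubic sector
through `e3OfK` (`e3OfK_inr_inr`) + `V` + Λ-sector (`JsB12CombSh0_S_succ`). -/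
theorem JsB12CombSh0_S_inr_inr (hn : Odd n) (N : ℕ) (tabs : SymTables 3 n) (cΛ cB : ℝ)
    (hVmm : ∀ (κ : Fin 4) (u x y : Fin 4 → ℤ) (m m' : Fin 4), tabs.V κ u x y (Sum.inr m) (Sum.inr m') = 0)
    (hHmm : ∀ (μ : Fin 4) (w x y : Fin 4 → ℤ) (m m' : Fin 4), tabs.H μ w x y (Sum.inr m) (Sum.inr m') = 0) :
    ∀ (j : ℕ) (κ : Fin 4) (u x y : Fin 4 → ℤ) (m m' : Fin 4), (JsB12CombSh0 hn N tabs cΛ cB j).S κ u x y (Sum.inr m) (Sum.inr m') = 0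
  | 0, κ, u, x, y, m, m' => by
    rw [JsB12CombSh0_S_zero]
    simp only [Pi.add_apply, Pi.smul_apply, smul_eq_mul]
    rw [hVmm, SLam_apply_eq_zero (fun μ w x' y' => hHmm μ w x' y' m m'),
      show wilsonA 3 κ u x y (Sum.inr m) (Sum.inr m') = 0 from rfl]
    ring
  | j + 1, κ, u, x, y, m, m' => by
    rw [JsB12CombSh0_S_succ]
    simp only [Pi.add_apply, Pi.smul_apply, smul_eq_mul]
    rw [hVmm, SLam_apply_eq_zero (fun μ w x' y' => hHmm μ w x' y' m m'), e3OfK_inr_inr]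
    ring

/-- [folklore] (V-mm) AT an1's RECORD: `symVhSAt` is packed by `packVH`, which has no mm block. -/
theorem symTablesAn1S2_V_inr_inr (cΛ : ℝ) (κ : Fin 4) (u x y : Fin 4 → ℤ) (m m' : Fin 4) :
    (symTablesAn1S2 3 n cΛ).V κ u x y (Sum.inr m) (Sum.inr m') = 0 := by
  rw [symTablesAn1S2_V]
  unfold symVhSAt
  rw [AveragingHessianKernels.packVH_inr_inr]

/-- [folklore] (H-mm) AT an1's RECORD: `symHessFFAt` lives on the field–field block (`symHessFFAt_inr`). -/
theorem symTablesAn1S2_H_inr_inr (cΛ : ℝ) (μ : Fin 4) (w x y : Fin 4 → ℤ) (m m' : Fin 4) :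
    (symTablesAn1S2 3 n cΛ).H μ w x y (Sum.inr m) (Sum.inr m') = 0 := by
  rw [symTablesAn1S2_H, symHessFFAt_inr]

/-- [folklore] **`hSmm` FOR THE RAW LITERAL OF RECORD** (every level). -/
theorem JsB12CombSh0_S_an1_inr_inr (hn : Odd n) (N : ℕ) (cΛ cB : ℝ) (j : ℕ) (κ : Fin 4) (u x y : Fin 4 → ℤ) (m m' : Fin 4) :
    (JsB12CombSh0 hn N (symTablesAn1S2 3 n cΛ) cΛ cB j).S κ u x y (Sum.inr m) (Sum.inr m') = 0 :=
  JsB12CombSh0_S_inr_inr hn N _ cΛ cB (symTablesAn1S2_V_inr_inr cΛ) (symTablesAn1S2_H_inr_inr cΛ) j κ u x y m m'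

/-- [folklore] **`hSfm` FOR THE RAW LITERAL OF RECORD** (every level). -/
theorem JsB12CombSh0_S_an1_inl_inr (hn : Odd n) (N : ℕ) (cΛ cB : ℝ) (j : ℕ) (κ : Fin 4) (u x y : Fin 4 → ℤ) (c b : Fin 4) :
    (JsB12CombSh0 hn N (symTablesAn1S2 3 n cΛ) cΛ cB j).S κ u x y (Sum.inl c) (Sum.inr b)
      = (JsB12CombSh0 hn N (symTablesAn1S2 3 n cΛ) cΛ cB j).S κ u y x (Sum.inr b) (Sum.inl c) :=
  fm_eq_of_parityOdd (trK_JsB12CombSh0_S_an1 hn N cΛ cB j κ u) x y c b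

/-- [folklore] **`hSff` FOR THE RAW LITERAL OF RECORD** (every level). -/
theorem JsB12CombSh0_S_an1_inl_inl (hn : Odd n) (N : ℕ) (cΛ cB : ℝ) (j : ℕ) (κ : Fin 4) (u x y : Fin 4 → ℤ) (c b : Fin 4) :
    (JsB12CombSh0 hn N (symTablesAn1S2 3 n cΛ) cΛ cB j).S κ u x y (Sum.inl c) (Sum.inl b)
      = -(JsB12CombSh0 hn N (symTablesAn1S2 3 n cΛ) cΛ cB j).S κ u y x (Sum.inl b) (Sum.inl c) :=
  ff_eq_of_parityOdd (trK_JsB12CombSh0_S_an1 hn N cΛ cB j κ u) x y c b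

/-- [folklore] **`hScovB` FOR THE RAW LITERAL** (any record, every level) — an2's `JsB12CombSh0_S_translate` in the END's cast shape. -/
theorem JsB12CombSh0_S_covB (hn : Odd n) (N : ℕ) (tabs : SymTables 3 n) (cΛ cB : ℝ) (j : ℕ) (κ : Fin 4) (u t : Fin 4 → ℤ) :
    (JsB12CombSh0 hn N tabs cΛ cB j).S κ (u + ((n : ℕ) : ℤ) • t) = shiftK (-(((n : ℕ) : ℤ) • t)) ((JsB12CombSh0 hn N tabs cΛ cB j).S κ u) :=
  JsB12CombSh0_S_translate hn N tabs cΛ cB j κ u t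

end Raw

/-! ## §4 `d + 1 = 4`: the DRESSED literal `(JsB12CombShSym hn N tabs cΛ cB j).S` — covariance, parity, mm block, the road's shapes, locality -/

section Dressed

variable {n : ℕ} [NeZero n]

/-- [folklore] **(St) FOR THE DRESSED (III′) LITERAL, ANY TABLE RECORD, EVERY LEVEL**: `S κ (u + n•t) = shiftK (−n•t) (S κ u)` (the raw `(St)` carried through
`dressAt` then `dressSymAt`). -/
theorem JsB12CombShSym_S_translate (hn : Odd n) (N : ℕ) (tabs : SymTables 3 n) (cΛ cB : ℝ) (j : ℕ) (κ : Fin 4) (u t : Fin 4 → ℤ) :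
    (JsB12CombShSym hn N tabs cΛ cB j).S κ (u + (n : ℤ) • t) = shiftK (-((n : ℤ) • t)) ((JsB12CombShSym hn N tabs cΛ cB j).S κ u) := by
  rw [JsB12CombShSym_eq]
  exact dressSymAt_S_translate _ _ (dressAt_S_translate _ _ (fun κ' u' t' => JsB12CombSh0_S_translate hn N tabs cΛ cB j κ' u' t')) κ u t

/-- [folklore] **THE DRESSED LITERAL IS ROW-PARITY-ODD, ANY RECORD UNDER (V-p)(H-p), EVERY LEVEL.** -/
theorem trK_JsB12CombShSym_S (hn : Odd n) (N : ℕ) (tabs : SymTables 3 n) (cΛ cB : ℝ)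
    (hVp : ∀ (κ : Fin 4) (u : Fin 4 → ℤ), trK (tabs.V κ u) = -sgnK (tabs.V κ u))
    (hHp : ∀ (μ : Fin 4) (y : Fin 4 → ℤ), trK (tabs.H μ y) = -sgnK (tabs.H μ y)) (j : ℕ) (κ : Fin 4) (u : Fin 4 → ℤ) :
    trK ((JsB12CombShSym hn N tabs cΛ cB j).S κ u) = -sgnK ((JsB12CombShSym hn N tabs cΛ cB j).S κ u) := by
  rw [JsB12CombShSym_eq]
  exact trK_dressSymAt_S _ _ (trK_dressAt_S _ _ (trK_JsB12CombSh0_S hn N tabs cΛ cB hVp hHp j)) κ u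

/-- [folklore] **THE DRESSED LITERAL HAS NO mm BLOCK, ANY RECORD UNDER (V-mm)(H-mm), EVERY LEVEL.** -/
theorem JsB12CombShSym_S_inr_inr (hn : Odd n) (N : ℕ) (tabs : SymTables 3 n) (cΛ cB : ℝ)
    (hVmm : ∀ (κ : Fin 4) (u x y : Fin 4 → ℤ) (m m' : Fin 4), tabs.V κ u x y (Sum.inr m) (Sum.inr m') = 0)
    (hHmm : ∀ (μ : Fin 4) (w x y : Fin 4 → ℤ) (m m' : Fin 4), tabs.H μ w x y (Sum.inr m) (Sum.inr m') = 0)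
    (j : ℕ) (κ : Fin 4) (u x y : Fin 4 → ℤ) (m m' : Fin 4) :
    (JsB12CombShSym hn N tabs cΛ cB j).S κ u x y (Sum.inr m) (Sum.inr m') = 0 := by
  rw [JsB12CombShSym_eq]
  exact dressSymAt_S_inr_inr _ _ (dressAt_S_inr_inr _ _ (JsB12CombSh0_S_inr_inr hn N tabs cΛ cB hVmm hHmm j)) κ u x y m m'

/-- [folklore] **THE DRESSED LITERAL OF RECORD IS ROW-PARITY-ODD** (an1's `symTablesAn1S2`; unconditional). -/
theorem trK_JsB12CombShSym_S_an1 (hn : Odd n) (N : ℕ) (cΛ cB : ℝ) (j : ℕ) (κ : Fin 4) (u : Fin 4 → ℤ) :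
    trK ((JsB12CombShSym hn N (symTablesAn1S2 3 n cΛ) cΛ cB j).S κ u) = -sgnK ((JsB12CombShSym hn N (symTablesAn1S2 3 n cΛ) cΛ cB j).S κ u) := by
  rw [JsB12CombShSym_eq]
  exact trK_dressSymAt_S _ _ (trK_dressAt_S _ _ (fun κ' u' => trK_JsB12CombSh0_S_an1 hn N cΛ cB j κ' u')) κ u

/-- [folklore] **`hSmm` FOR THE DRESSED LITERAL OF RECORD** (every level). -/
theorem JsB12CombShSym_S_an1_inr_inr (hn : Odd n) (N : ℕ) (cΛ cB : ℝ) (j : ℕ) (κ : Fin 4) (u x y : Fin 4 → ℤ) (m m' : Fin 4) :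
    (JsB12CombShSym hn N (symTablesAn1S2 3 n cΛ) cΛ cB j).S κ u x y (Sum.inr m) (Sum.inr m') = 0 :=
  JsB12CombShSym_S_inr_inr hn N _ cΛ cB (symTablesAn1S2_V_inr_inr cΛ) (symTablesAn1S2_H_inr_inr cΛ) j κ u x y m m'

/-- [folklore] **`hSfm` FOR THE DRESSED LITERAL OF RECORD** (every level). -/
theorem JsB12CombShSym_S_an1_inl_inr (hn : Odd n) (N : ℕ) (cΛ cB : ℝ) (j : ℕ) (κ : Fin 4) (u x y : Fin 4 → ℤ) (c b : Fin 4) :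
    (JsB12CombShSym hn N (symTablesAn1S2 3 n cΛ) cΛ cB j).S κ u x y (Sum.inl c) (Sum.inr b)
      = (JsB12CombShSym hn N (symTablesAn1S2 3 n cΛ) cΛ cB j).S κ u y x (Sum.inr b) (Sum.inl c) :=
  fm_eq_of_parityOdd (trK_JsB12CombShSym_S_an1 hn N cΛ cB j κ u) x y c b

/-- [folklore] **`hSff` FOR THE DRESSED LITERAL OF RECORD** (every level). -/
theorem JsB12CombShSym_S_an1_inl_inl (hn : Odd n) (N : ℕ) (cΛ cB : ℝ) (j : ℕ) (κ : Fin 4) (u x y : Fin 4 → ℤ) (c b : Fin 4) :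
    (JsB12CombShSym hn N (symTablesAn1S2 3 n cΛ) cΛ cB j).S κ u x y (Sum.inl c) (Sum.inl b)
      = -(JsB12CombShSym hn N (symTablesAn1S2 3 n cΛ) cΛ cB j).S κ u y x (Sum.inl b) (Sum.inl c) :=
  ff_eq_of_parityOdd (trK_JsB12CombShSym_S_an1 hn N cΛ cB j κ u) x y c b

/-- [folklore] **S1: THE DRESSED LITERAL's STENCIL CONSTANT IS NONNEGATIVE** (read off its own `LocStencil` certificate). -/
theorem JsB12CombShSym_Cs_nonneg (hn : Odd n) (N : ℕ) (tabs : SymTables 3 n) (cΛ cB : ℝ) (j : ℕ) :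
    0 ≤ (JsB12CombShSym hn N tabs cΛ cB j).Cs :=
  ((JsB12CombShSym hn N tabs cΛ cB j).loc 0 0).nonneg (Sum.inl 0)

end Dressed

/-! ## §5 At an2's one-shot composite jets `JcOf hLc N cΛ cB m` (blocking `n = Lc^m`): the seven sockets in the END's binder shapes -/

section OneShot

variable {Lc : ℕ} [NeZero Lc]

/-- [folklore] **`hS` AT `JcOf`**: the one-shot datum's own `LocStencil` certificate. -/
theorem JcOf_locStencil (hLc : Odd Lc) (N : ℕ) (cΛ cB : ℕ → ℝ) (m : ℕ) :
    LocStencil (JcOf hLc N cΛ cB m).S (JcOf hLc N cΛ cB m).Cs (JcOf hLc N cΛ cB m).δ :=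
  (JcOf hLc N cΛ cB m).loc

/-- [folklore] **`hCs` AT `JcOf`.** -/
theorem JcOf_Cs_nonneg (hLc : Odd Lc) (N : ℕ) (cΛ cB : ℕ → ℝ) (m : ℕ) : 0 ≤ (JcOf hLc N cΛ cB m).Cs :=
  ((JcOf hLc N cΛ cB m).loc 0 0).nonneg (Sum.inl 0)

/-- [folklore] **`hδS` AT `JcOf`.** -/
theorem JcOf_δ_pos (hLc : Odd Lc) (N : ℕ) (cΛ cB : ℕ → ℝ) (m : ℕ) : 0 < (JcOf hLc N cΛ cB m).δ :=
  (JcOf hLc N cΛ cB m).δ_pos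

/-- [folklore] **`hScovB` AT `JcOf`**: `S κ (u + (Lc^m)•t) = shiftK (−(Lc^m)•t) (S κ u)`. -/
theorem JcOf_S_covB (hLc : Odd Lc) (N : ℕ) (cΛ cB : ℕ → ℝ) (m : ℕ) (κ : Fin 4) (u t : Fin 4 → ℤ) :
    (JcOf hLc N cΛ cB m).S κ (u + ((Lc ^ m : ℕ) : ℤ) • t) = shiftK (-(((Lc ^ m : ℕ) : ℤ) • t)) ((JcOf hLc N cΛ cB m).S κ u) := by
  rw [JcOf_apply]
  exact JsB12CombShSym_S_translate (n := Lc ^ m) hLc.pow N _ _ _ 0 κ u t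

/-- [folklore] **`hSmm` AT `JcOf`.** -/
theorem JcOf_S_inr_inr (hLc : Odd Lc) (N : ℕ) (cΛ cB : ℕ → ℝ) (m : ℕ) (κ : Fin 4) (u x y : Fin 4 → ℤ) (c b : Fin 4) :
    (JcOf hLc N cΛ cB m).S κ u x y (Sum.inr c) (Sum.inr b) = 0 := by
  rw [JcOf_apply]
  exact JsB12CombShSym_S_an1_inr_inr (n := Lc ^ m) hLc.pow N _ _ 0 κ u x y c b

/-- [folklore] **`hSfm` AT `JcOf`.** -/
theorem JcOf_S_inl_inr (hLc : Odd Lc) (N : ℕ) (cΛ cB : ℕ → ℝ) (m : ℕ) (κ : Fin 4) (u x y : Fin 4 → ℤ) (c b : Fin 4) :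
    (JcOf hLc N cΛ cB m).S κ u x y (Sum.inl c) (Sum.inr b) = (JcOf hLc N cΛ cB m).S κ u y x (Sum.inr b) (Sum.inl c) := by
  rw [JcOf_apply]
  exact JsB12CombShSym_S_an1_inl_inr (n := Lc ^ m) hLc.pow N _ _ 0 κ u x y c b

/-- [folklore] **`hSff` AT `JcOf`.** -/
theorem JcOf_S_inl_inl (hLc : Odd Lc) (N : ℕ) (cΛ cB : ℕ → ℝ) (m : ℕ) (κ : Fin 4) (u x y : Fin 4 → ℤ) (c b : Fin 4) :
    (JcOf hLc N cΛ cB m).S κ u x y (Sum.inl c) (Sum.inl b) = -(JcOf hLc N cΛ cB m).S κ u y x (Sum.inl b) (Sum.inl c) := by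
  rw [JcOf_apply]
  exact JsB12CombShSym_S_an1_inl_inl (n := Lc ^ m) hLc.pow N _ _ 0 κ u x y c b

/-- [folklore] **THE ONE-SHOT DATUM IS ROW-PARITY-ODD** (for parity-form consumers: `trK S = -sgnK S`). -/
theorem trK_JcOf_S (hLc : Odd Lc) (N : ℕ) (cΛ cB : ℕ → ℝ) (m : ℕ) (κ : Fin 4) (u : Fin 4 → ℤ) :
    trK ((JcOf hLc N cΛ cB m).S κ u) = -sgnK ((JcOf hLc N cΛ cB m).S κ u) := by
  rw [JcOf_apply]
  exact trK_JsB12CombShSym_S_an1 (n := Lc ^ m) hLc.pow N _ _ 0 κ u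

end OneShot

/-! ## §6 Def-free `by_cases` wrappers for an ODD-INDEXED PIN `S n := if h : Odd n then F n h else 0` (PART 23 decides `F`: the dressed literal — §4 —
or the raw tables — §3 — at blocking `n`; the END's binder `S : ℕ → …` keeps its shape and its `∀ n ≥ 2` sockets follow from the per-datum lemmas) -/

section Pin

variable {d : ℕ}

/-- [folklore] `shiftK v 0 = 0`. -/
theorem shiftK_zero' (v : Fin (d + 1) → ℤ) : shiftK v (0 : MKer (d + 1) (Fib d)) = 0 := by
  funext x y a b
  simp [shiftK]

/-- [folklore] the zero stencil family is a local stencil family for every nonnegative constant and every rate. -/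
theorem locStencil_zero {C δ : ℝ} (hC : 0 ≤ C) :
    LocStencil (fun (_ : Fin (d + 1)) (_ : Fin (d + 1) → ℤ) => (0 : MKer (d + 1) (Fib d))) C δ := by
  intro κ u x y a b
  simp only [Pi.zero_apply, abs_zero]
  positivity

/-- [folklore] **THE ODD-INDEXED PIN: BLOCK COVARIANCE.**  For `S n := if h : Odd n then F n h else 0`, block covariance `∀ n` follows from that of every `F n h`. -/
theorem pin_covB (F : ∀ n : ℕ, Odd n → Fin (d + 1) → (Fin (d + 1) → ℤ) → MKer (d + 1) (Fib d))
    (hF : ∀ (n : ℕ) (h : Odd n) (κ : Fin (d + 1)) (u t : Fin (d + 1) → ℤ),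
      F n h κ (u + ((n : ℕ) : ℤ) • t) = shiftK (-(((n : ℕ) : ℤ) • t)) (F n h κ u))
    (n : ℕ) (κ : Fin (d + 1)) (u t : Fin (d + 1) → ℤ) :
    (fun n : ℕ => if h : Odd n then F n h else 0) n κ (u + ((n : ℕ) : ℤ) • t)
      = shiftK (-(((n : ℕ) : ℤ) • t)) ((fun n : ℕ => if h : Odd n then F n h else 0) n κ u) := by
  by_cases h : Odd n
  · simp only [dif_pos h]
    exact hF n h κ u t
  · simp only [dif_neg h, Pi.zero_apply]
    exact (shiftK_zero' _).symm

/-- [folklore] **THE ODD-INDEXED PIN: AN ENTRY IDENTITY** (the `hSmm ∕ hSfm ∕ hSff` shapes are entrywise linear relations with zero right-hand side at `0`):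
if every `F n h` satisfies `F n h κ u x y a b = c * F n h κ u y x b' a'` then so does the pin. -/
theorem pin_entry (F : ∀ n : ℕ, Odd n → Fin (d + 1) → (Fin (d + 1) → ℤ) → MKer (d + 1) (Fib d)) (c : ℝ) (a b a' b' : Fib d)
    (hF : ∀ (n : ℕ) (h : Odd n) (κ : Fin (d + 1)) (u x y : Fin (d + 1) → ℤ), F n h κ u x y a b = c * F n h κ u y x b' a')
    (n : ℕ) (κ : Fin (d + 1)) (u x y : Fin (d + 1) → ℤ) :
    (fun n : ℕ => if h : Odd n then F n h else 0) n κ u x y a b = c * (fun n : ℕ => if h : Odd n then F n h else 0) n κ u y x b' a' := by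
  by_cases h : Odd n
  · simp only [dif_pos h]
    exact hF n h κ u x y
  · simp only [dif_neg h, Pi.zero_apply, mul_zero]

/-- [folklore] **THE ODD-INDEXED PIN: VANISHING ENTRIES** (the `hSmm` shape). -/
theorem pin_entry_zero (F : ∀ n : ℕ, Odd n → Fin (d + 1) → (Fin (d + 1) → ℤ) → MKer (d + 1) (Fib d)) (a b : Fib d)
    (hF : ∀ (n : ℕ) (h : Odd n) (κ : Fin (d + 1)) (u x y : Fin (d + 1) → ℤ), F n h κ u x y a b = 0)
    (n : ℕ) (κ : Fin (d + 1)) (u x y : Fin (d + 1) → ℤ) :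
    (fun n : ℕ => if h : Odd n then F n h else 0) n κ u x y a b = 0 := by
  by_cases h : Odd n
  · simp only [dif_pos h]
    exact hF n h κ u x y
  · simp only [dif_neg h, Pi.zero_apply]

/-- [folklore] **THE ODD-INDEXED PIN: LOCALITY** with the pinned constants `Cs n := if h : Odd n then C n h else 0`, `δS n := if h : Odd n then δ n h else 1`. -/
theorem pin_locStencil (F : ∀ n : ℕ, Odd n → Fin (d + 1) → (Fin (d + 1) → ℤ) → MKer (d + 1) (Fib d)) (C δ : ∀ n : ℕ, Odd n → ℝ)
    (hF : ∀ (n : ℕ) (h : Odd n), LocStencil (F n h) (C n h) (δ n h)) (n : ℕ) :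
    LocStencil ((fun n : ℕ => if h : Odd n then F n h else 0) n) ((fun n : ℕ => if h : Odd n then C n h else 0) n)
      ((fun n : ℕ => if h : Odd n then δ n h else 1) n) := by
  by_cases h : Odd n
  · simp only [dif_pos h]
    exact hF n h
  · simp only [dif_neg h]
    exact locStencil_zero le_rfl

/-- [folklore] the pinned constants are nonnegative when the odd ones are. -/
theorem pin_Cs_nonneg (C : ∀ n : ℕ, Odd n → ℝ) (hC : ∀ (n : ℕ) (h : Odd n), 0 ≤ C n h) (n : ℕ) :
    0 ≤ (fun n : ℕ => if h : Odd n then C n h else 0) n := by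
  by_cases h : Odd n
  · simp only [dif_pos h]; exact hC n h
  · simp only [dif_neg h]; exact le_rfl

/-- [folklore] the pinned rates are positive when the odd ones are. -/
theorem pin_δ_pos (δ : ∀ n : ℕ, Odd n → ℝ) (hδ : ∀ (n : ℕ) (h : Odd n), 0 < δ n h) (n : ℕ) :
    0 < (fun n : ℕ => if h : Odd n then δ n h else 1) n := by
  by_cases h : Odd n
  · simp only [dif_pos h]; exact hδ n h
  · simp only [dif_neg h]; exact one_pos

/-- [folklore] **ONE ADMISSIBLE PIN READ AT THE SCALES** (`J1-RESIDUE-SPEC` §1 with the locks indexed through `Nat.log Lc`, the OWNER's PART 22 device; PART 23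
decides): at `n = Lc^m` the odd-indexed pin of the dressed literal of record IS `(JcOf hLc N cΛ cB m).S` (`dif_pos hLc.pow`, `Nat.log_pow`; `.S` has a
blocking-independent type, so no transport lemma is needed). -/
theorem pin_dressed_at_pow {Lc : ℕ} [NeZero Lc] (hLc : Odd Lc) (hL : 1 < Lc) (N : ℕ) (cΛ cB : ℕ → ℝ) (m : ℕ) :
    (fun n : ℕ => if h : Odd n then (haveI : NeZero n := ⟨h.pos.ne'⟩;
        (JsB12CombShSym (Lc := n) h N (symTablesAn1S2 3 n (cΛ (Nat.log Lc n))) (cΛ (Nat.log Lc n)) (cB (Nat.log Lc n)) 0).S) else 0) (Lc ^ m)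
      = (JcOf hLc N cΛ cB m).S := by
  have h : Odd (Lc ^ m) := hLc.pow
  simp only [dif_pos h, Nat.log_pow hL, JcOf_apply]

end Pin

end Summit.QuantumFields.BalabanUV.Beta.D1BFx.LiteralStencilSockets

end
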